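import Summits.HodgeConjecture.HodgeConjecture.Theorems.F0P6bWDockPackage   -- ★ previous part of the same Lines workfile (size-lint split; same namespace `Summit.HodgeConjecture.HodgeConjecture.Cruxes.HLiu418.F0P6bWDock`)
import HarnessLib

/-!
# `F0P6bWDockWBlockLaw` — ★ RE-HOME of `Lines/F0_P6b_WDock.lean` (tree ED. 4 7d61e77295a90030), PART 2 of 4 — §6 (ED. 3∕4) the `w`-block section `WBlockLaw` (`rL_W`, `rL_W′`, `hqβ_of_descends∕_of_roof4`, `law_w`).

See PART 1 `Theorems/F0P6bWDockPackage.lean` for the full re-home header and the original module docstring (verbatim there). Namespace KEPT: `Summit.HodgeConjecture.HodgeConjecture.Cruxes.HLiu418.F0P6bWDock`;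
code bytes = the workfile՚s, docstrings included; preamble (options ∕ `noncomputable section` ∕ `universe u` ∕ `open`s) repeated verbatim from PART 1.
HC_CM is proved only modulo the 7 printed citations (2 remaining: hLiu418 = stmt-HodgeConjecture-24832, h413 = stmt-HodgeConjecture-24833) until rung 0 closes; a re-home is count-neutral. -/

set_option autoImplicit false
set_option linter.dupNamespace false

-- Mathlib's `Over`/`Scheme` APIs are stated across semireducible wrappers (as in the two P6b Lines modules imported here).
set_option backward.isDefEq.respectTransparency false

noncomputable section

universe u

open CategoryTheory CategoryTheory.Limits AlgebraicGeometry MonoidalCategory CartesianMonoidalCategory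
open scoped MonObj
open Literature.AlgebraicGeometry.GroupSchemes Literature.AlgebraicGeometry.GroupSchemes.GroupSchemeKernel
open Literature.AlgebraicGeometry.GroupSchemes.AffineGroupScheme Literature.AlgebraicGeometry.GroupSchemes.TorsionLayer
open Literature.AlgebraicGeometry.Motives Literature.AlgebraicGeometry.Motives.AbelianVariety
open Literature.AlgebraicGeometry.AbelianSchemes Literature.AlgebraicGeometry.AbelianSchemes.AbelianSchemeOver
open Literature.AlgebraicGeometry.AbelianSchemes.AbelianSchemeOver.DualPair
open Summit.HodgeConjecture.HodgeConjecture.Cruxes.HLiu418.F0P6bWeilCartierDuality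
open Literature.AlgebraicGeometry.Motives.AbelianVarietyFrobeniusBlockLagrangian   -- (BLF)՚s ★ namespace (was `…Cruxes.HLiu418.F0P6bFrobeniusLagrangian`)

namespace Summit.HodgeConjecture.HodgeConjecture.Cruxes.HLiu418.F0P6bWDock

/-! ## §6 (ED. 3) THE `w`-BLOCK SECTION OF THE FROBENIUS-KERNEL LAW (rL) — (E2-DOCK-W) TYPED AND PAID

LA3-plan (g0) `CENSUS-L3-organs.v1` §3 row (rL-w) «`w`-block: `𝔠_w = 𝔭_w^{e_w f_w − 1}`, Cartier dual of the `c•w`-block — hand P6b desk + LA3-p03».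
Stated over the OBTAINED DATA of `WDockPackage` (`G j β W jW 𝒢l Φ𝒢 φ𝒢 eW` + the laws (α)(iii)(v) as named hypotheses) plus the ROOF road՚s datum
`q̄ : A → B̄`, the co-ideal `𝔠`, a SHIFT ELEMENT `s : 𝒪` (`v_w(s) = v_w(𝔠) = e_w f_w − 1`; `s = p^{r−1}` when `e_w = 1`, `r = f_w`) and a closed subgroup
`κ : 𝒦 ↪ 𝒢l` reading `Ker q̄` on the `c•w`-layer; everything here is sorry-free:
* `WBlockLaw.layerEnd_natCast` (`β n = [n]_G`), `WBlockLaw.comp_comp_zsmul_id` (`(z ≫ j) ≫ [m]_A = (z ≫ β m) ≫ j`) — token lemmas of the (α) calculus;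
* `WBlockLaw.rlw_shift` — on `W`, «killed by `ι(𝔠) ≫ q̄`» ↔ «killed by `β s ≫ q̄`», from the two ARITHMETIC ROWS `h𝔠₁`/`h𝔠₂` («`𝔠·ē ≡ s·ē (mod q)`», `ē = star εu`
  the `w`-idempotent) and the `β`-stability `hqβ` of `Ker q̄ ∩ A[q]` (`Roof₀` (r4₀)); `WBlockLaw.rlw_shift_natCast` = the instance `s = p^{r−1}` in the `[p^{r−1}]_A` token;
* `WBlockLaw.exists_annihilator_iff_of_factor` — annihilator transport along (E) HEART-FROB′ (`Φ𝒢 = 𝒦` as subgroups of `𝒢l`; ★ `annihilatorMapOfLE`);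
* `WBlockLaw.exists_annihilator_iff_of_dock`, `WBlockLaw.kw_of_dock` — the docking law (iv) `jW ≫ e₀ ≫ j𝒢^D = eW` converts the socket (KW) into `e₀`-currency on
  `G`-points: (KW₀) «`β(s)x` killed by `j ≫ q̄` ↔ `((x ≫ jW) ≫ e₀) ≫ (κ ≫ j𝒢)^D = 1`» (no annihilator object; ★ `exists_eq_comp_annihilatorι_iff`, ★ `cartierDualMap_comp`);
* HEAD `WBlockLaw.rL_W` : `∀ x : T ⟶ W, ((x ≫ jW) ≫ j) ≫ F^{(r)} = 1 ↔ ∀ a ∈ 𝔠, ((x ≫ jW) ≫ j) ≫ ι(a) ≫ q̄ = 1` over the sockets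
  (KW) «`β(s)x ∈ Ker q̄ ↔ x ∈ ann_{eW}(𝒦)`» (= the BLOCK READING «`Ker F ∩ A[w^∞] = [ϖ_w^{d_w−1}]⁻¹ sp(N)`, `N = H_L^⊥`» of `Roof₀`'s docstring through the Weil level
  shift `e_q(x, ℓ) = e_p(s·x, ℓ)`; LATTICE CHECK of `RoofΩ`, [MumfordAV1970] §23) and (E); `WBlockLaw.rL_W'` re-reads it on `A`-points `t` with `t ≫ [q] = 1`,
  `t ≫ ι(ē) = t` — the `law_W` input of ★ (E2-asm) `AbelianVariety.comp_relFrobenius_eq_one_iff_of_blocks` at `ε_W = ι(ē)`, `Φ = ι(𝔠)`, `q = q̄`.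
* (ED. 4) `WBlockLaw.hqβ_of_descends`∕`WBlockLaw.hqβ_of_roof4` — the socket `hqβ` from `Roof₀` (r4₀) `∀ a, ∃ b : B̄ → B̄, ι(a) ≫ q̄ = q̄ ≫ b ∧ ι″(a) ≫ c̄ = c̄ ≫ b`
  (so `hqβ` below is (r4₀), and the two arithmetic rows are ★ `NumberFields/FrobeniusCoidealBlockCongruence.frobCoideal_block_rows`); `WBlockLaw.law_w` — the HEAD
  `rL_W'` in the `law`-binder currency of ★ (rL-asm) `AbelianSchemes/FrobeniusKernelLawBlockAssembly.comp_relFrobeniusOver_eq_one_iff_of_torsion_blocks` at the `w`-index.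
So on the `w`-block the ROOF road owes exactly (KW) + (E) + the two arithmetic rows + `hqβ`; the dock geometry ((v), (iii), (α)) is consumed here. -/

namespace WBlockLaw

variable {k : Type u} [Field k] (p r : ℕ) (A : AbelianSchemeOver (Spec (.of k))) {O : Type} [CommRing O] (star : O →+* O)
  (act : A.RingAction O) (εu : O)
  -- the torsion layer `G = A[q]` and the layer action `β` (package data; only the instances each statement needs)
  (G : SchemeOver k) [GrpObj G] [IsCommMonObj G] (j : G ⟶ A.X) (β : O → (G ⟶ G))
  -- the `w`-layer `W = Fix β(ē)` (package data)
  (W : SchemeOver k) (jW : W ⟶ G)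

/-! ## §1 Two token lemmas of the layer calculus, and the arithmetic shift on the `w`-layer (sorry-free) -/

/-- `β n = [n]_G` for `n : ℕ`, from the (α) laws `β 1 = 𝟙`, `β (a + b) = β a * β b`. [cite: MumfordAV1970, §19 Thm. 4 (p. 180)] -/
theorem layerEnd_natCast (hβ1 : β 1 = 𝟙 G) (hβadd : ∀ a b, β (a + b) = β a * β b) (n : ℕ) : β (n : O) = (𝟙 G) ^ n := by
  have hβ0 : β 0 = 1 := by
    have h : β 0 * β 0 = β 0 * 1 := by rw [mul_one, ← hβadd, add_zero]
    exact mul_left_cancel h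
  induction n with
  | zero =>
    rw [Nat.cast_zero, hβ0]
    exact (_root_.pow_zero _).symm
  | succ n ih => rw [Nat.cast_succ, hβadd, ih, hβ1, _root_.pow_succ]

/-- The torsion token of the package read through `β`: `(z ≫ j) ≫ [m]_A = (z ≫ β m) ≫ j` (`[m]_A = (m • 𝟙 A).hom.hom.hom`, ★ `mulN_eq_zsmul_id`, `MonObj.comp_pow`∕`pow_comp`).
[cite: MumfordAV1970, §4 Cor. 1 (p. 43), §19 Thm. 4 (p. 180)] -/
theorem comp_comp_zsmul_id [IsMonHom j] (hβ1 : β 1 = 𝟙 G) (hβadd : ∀ a b, β (a + b) = β a * β b) (m : ℕ) ⦃T : SchemeOver k⦄ (z : T ⟶ G) :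
    (z ≫ j) ≫ ((((m : ℕ) : ℤ) • 𝟙 A.toAffine.toAbelianVariety).hom.hom.hom) = (z ≫ β (m : O)) ≫ j := by
  rw [← mulN_eq_zsmul_id A m, AbelianSchemeOver.mulN_def, MonObj.comp_pow, Category.comp_id, layerEnd_natCast G β hβ1 hβadd, Category.assoc,
    MonObj.pow_comp, Category.id_comp, MonObj.comp_pow]

/-- **`rlw_shift`** (sorry-free; ANY shift element `s : 𝒪`) — on the `w`-layer `W`, «`x` is killed by `ι(a) ≫ q̄` for every `a ∈ 𝔠`» iff «`x` is killed by `β s ≫ q̄`».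
Inputs: the arithmetic rows `h𝔠₁` («every `a ∈ 𝔠` has `a·ē = s·b + q·c₁`») and `h𝔠₂` («some `a ∈ 𝔠` has `s·ē = a·b + q·c₂`») — the number-field fact
`𝔠 + 𝔭_w^{e f} = 𝔭_w^{e f − 1} = (s) + 𝔭_w^{e f}` (`v_w(𝔠) = v_w(s) = e_w f_w − 1`; for `e_w = 1`, `r = f_w`: `s = p^{r−1}`) read through the CRT idempotent `ē` of the `w`-factor of
`𝒪 ∕ q` — and the `β`-stability `hqβ` of «killed by `j ≫ q̄`» (from `Roof₀` (r4₀)).  Proof: on `W`, `x = x ≫ β ē` (`hW`); `β` is additive and anti-multiplicative with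
`β(q·c) = 1` (`layerEnd_natCast`, `hβmul`, `hq`); `(z ≫ j) ≫ ι(a) = (z ≫ β a) ≫ j` (`hβj`); then each direction is ONE use of `hqβ` through its row.
[cite: MumfordAV1970, §19 Thm. 4 (p. 180), §20 (I) p. 186] [cite: Liu2021, Prop. D.8 (3) pp. 136–138] -/
theorem rlw_shift
    -- package laws: (α) the layer calculus of `β`, (iii) the `W`-reading
    (hβj : ∀ a, β a ≫ j = j ≫ act.i a) (hβ1 : β 1 = 𝟙 G) (hβadd : ∀ a b, β (a + b) = β a * β b)
    (hβmul : ∀ a b, β (a * b) = β b ≫ β a) (hq : (𝟙 G) ^ (p ^ r) = 1)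
    (hW : ∀ ⦃T : SchemeOver k⦄ (x : T ⟶ G), (∃ s : T ⟶ W, s ≫ jW = x) ↔ x ≫ β (star εu) = x)
    -- the ROOF road's datum `q̄ : A → B̄`, co-ideal `𝔠`, shift element `s`; `Ker q̄ ∩ A[q]` is `β`-stable; the two arithmetic rows
    {B : AbelianSchemeOver (Spec (.of k))} (qbar : A.X ⟶ B.X) (𝔠 : Ideal O) (s : O)
    (hqβ : ∀ (b : O) ⦃T : SchemeOver k⦄ (z : T ⟶ G), (z ≫ j) ≫ qbar = 1 → ((z ≫ β b) ≫ j) ≫ qbar = 1)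
    (h𝔠₁ : ∀ a ∈ 𝔠, ∃ b c₁ : O, a * star εu = s * b + (p ^ r : ℕ) * c₁)
    (h𝔠₂ : ∃ a ∈ 𝔠, ∃ b c₂ : O, s * star εu = a * b + (p ^ r : ℕ) * c₂)
    ⦃T : SchemeOver k⦄ (x : T ⟶ W) :
    (∀ a ∈ 𝔠, ((x ≫ jW) ≫ j) ≫ act.i a ≫ qbar = 1) ↔ (((x ≫ jW) ≫ β s) ≫ j) ≫ qbar = 1 := by
  -- (1) `β (q * c) = 1`
  have hβq : ∀ c : O, β ((p ^ r : ℕ) * c) = 1 := by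
    intro c
    rw [hβmul, layerEnd_natCast G β hβ1 hβadd, hq, MonObj.comp_one]
  -- (2) the action token: `(z ≫ j) ≫ ι(a) = (z ≫ β a) ≫ j`
  have hact : ∀ (a : O) (z : T ⟶ G), (z ≫ j) ≫ act.i a = (z ≫ β a) ≫ j := by
    intro a z
    rw [Category.assoc, ← hβj, Category.assoc]
  -- (3) `x` lies on `W = Fix β(ē)`
  have hxe : (x ≫ jW) ≫ β (star εu) = x ≫ jW := (hW (x ≫ jW)).1 ⟨x, rfl⟩
  -- (4) the two readings of `(x ≫ jW) ≫ β (·)` through the arithmetic rows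
  have key : ∀ (a b c m : O), a * star εu = m * b + (p ^ r : ℕ) * c → (x ≫ jW) ≫ β a = ((x ≫ jW) ≫ β m) ≫ β b := by
    intro a b c m h
    calc (x ≫ jW) ≫ β a = ((x ≫ jW) ≫ β (star εu)) ≫ β a := by rw [hxe]
      _ = (x ≫ jW) ≫ β (a * star εu) := by rw [Category.assoc, ← hβmul]
      _ = (x ≫ jW) ≫ (β (m * b) * β ((p ^ r : ℕ) * c)) := by rw [h, hβadd]
      _ = (x ≫ jW) ≫ β (b * m) := by rw [hβq, mul_one, mul_comm m b]
      _ = ((x ≫ jW) ≫ β m) ≫ β b := by simp only [hβmul, Category.assoc]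
  constructor
  · -- (→): pick `a₀ ∈ 𝔠` with `s·ē = a₀·b + q·c₂`
    intro h
    obtain ⟨a₀, ha₀, b, c₂, h₂⟩ := h𝔠₂
    have hm : (x ≫ jW) ≫ β s = ((x ≫ jW) ≫ β a₀) ≫ β b := key _ b c₂ a₀ (by rw [h₂])
    have h0 : (((x ≫ jW) ≫ β a₀) ≫ j) ≫ qbar = 1 := by
      have := h a₀ ha₀
      rw [← Category.assoc ((x ≫ jW) ≫ j), hact] at this
      exact this
    rw [hm]
    exact hqβ b ((x ≫ jW) ≫ β a₀) h0
  · -- (←): every `a ∈ 𝔠` has `a·ē = s·b + q·c₁`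
    intro hm a ha
    obtain ⟨b, c₁, h₁⟩ := h𝔠₁ a ha
    rw [← Category.assoc ((x ≫ jW) ≫ j), hact, key a b c₁ _ h₁]
    exact hqβ b _ hm

/-- **`rlw_shift_natCast`** — the unramified instance `s = p^{r−1}` (`e_w = 1`, `r = f_w`) in the package's `[p^{r−1}]_A` token.
[cite: MumfordAV1970, §19 Thm. 4 (p. 180), §20 (I) p. 186] [cite: Liu2021, Prop. D.8 (3) pp. 136–138] -/
theorem rlw_shift_natCast [IsMonHom j]
    (hβj : ∀ a, β a ≫ j = j ≫ act.i a) (hβ1 : β 1 = 𝟙 G) (hβadd : ∀ a b, β (a + b) = β a * β b)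
    (hβmul : ∀ a b, β (a * b) = β b ≫ β a) (hq : (𝟙 G) ^ (p ^ r) = 1)
    (hW : ∀ ⦃T : SchemeOver k⦄ (x : T ⟶ G), (∃ s : T ⟶ W, s ≫ jW = x) ↔ x ≫ β (star εu) = x)
    {B : AbelianSchemeOver (Spec (.of k))} (qbar : A.X ⟶ B.X) (𝔠 : Ideal O)
    (hqβ : ∀ (b : O) ⦃T : SchemeOver k⦄ (z : T ⟶ G), (z ≫ j) ≫ qbar = 1 → ((z ≫ β b) ≫ j) ≫ qbar = 1)
    (h𝔠₁ : ∀ a ∈ 𝔠, ∃ b c₁ : O, a * star εu = (p ^ (r - 1) : ℕ) * b + (p ^ r : ℕ) * c₁)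
    (h𝔠₂ : ∃ a ∈ 𝔠, ∃ b c₂ : O, ((p ^ (r - 1) : ℕ) : O) * star εu = a * b + (p ^ r : ℕ) * c₂)
    ⦃T : SchemeOver k⦄ (x : T ⟶ W) :
    (∀ a ∈ 𝔠, ((x ≫ jW) ≫ j) ≫ act.i a ≫ qbar = 1) ↔
      (((x ≫ jW) ≫ j) ≫ ((((p ^ (r - 1) : ℕ) : ℤ) • 𝟙 A.toAffine.toAbelianVariety).hom.hom.hom)) ≫ qbar = 1 := by
  rw [comp_comp_zsmul_id A G j β hβ1 hβadd (p ^ (r - 1)) (x ≫ jW)]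
  exact rlw_shift p r A star act εu G j β W jW hβj hβ1 hβadd hβmul hq hW qbar 𝔠 _ hqβ h𝔠₁ h𝔠₂ x

/-! ## §2 Annihilator transport along the HEART-FROB′ identification (closed helper) -/

/-- If `𝒦` and `Φ𝒢` are the same subgroup of `𝒢l` (mutual factorisations `t`, `t'`), their `eW`-annihilators in `W` have the same `T`-points
(★ antitonicity `annihilatorMapOfLE` both ways). [cite: Tate1997FiniteFlatGroupSchemes, §(3.8) p. 146] [cite: GortzWedhorn2020, Def. 4.45 (2) p. 117] -/
theorem exists_annihilator_iff_of_factor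
    -- the `c•w`-layer `𝒢l`, its Frobenius sublayer `Φ𝒢`, the dock `eW` (package data) and the kernel reading `κ : 𝒦 ↪ 𝒢l` of `q̄` (ROOF road)
    (𝒢l : SchemeOver k) [GrpObj 𝒢l] [IsCommMonObj 𝒢l] [IsAffine 𝒢l.left]
    (Φ𝒢 : SchemeOver k) [GrpObj Φ𝒢] [IsCommMonObj Φ𝒢] [IsAffine Φ𝒢.left] [Module.Free k (Alg Φ𝒢)] [Module.Finite k (Alg Φ𝒢)]
    (φ𝒢 : Φ𝒢 ⟶ 𝒢l) [IsMonHom φ𝒢]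
    (𝒦 : SchemeOver k) [GrpObj 𝒦] [IsCommMonObj 𝒦] [IsAffine 𝒦.left] [Module.Free k (Alg 𝒦)] [Module.Finite k (Alg 𝒦)]
    (κ : 𝒦 ⟶ 𝒢l) [IsMonHom κ] (eW : W ≅ cartierDual 𝒢l)
    -- (E) HEART-FROB′ on the `c•w`-layer: `Φ𝒢` and `𝒦` are the same subgroup of `𝒢l`
    (t : Φ𝒢 ⟶ 𝒦) [IsMonHom t] (ht : t ≫ κ = φ𝒢) (t' : 𝒦 ⟶ Φ𝒢) [IsMonHom t'] (ht' : t' ≫ φ𝒢 = κ)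
    ⦃T : SchemeOver k⦄ (x : T ⟶ W) :
    (∃ c : T ⟶ annihilator κ, c ≫ (annihilatorι κ ≫ eW.inv) = x) ↔
      ∃ c : T ⟶ annihilator φ𝒢, c ≫ (annihilatorι φ𝒢 ≫ eW.inv) = x := by
  constructor
  · rintro ⟨c, hc⟩
    refine ⟨c ≫ annihilatorMapOfLE φ𝒢 κ t ht, ?_⟩
    rw [Category.assoc, ← Category.assoc (annihilatorMapOfLE φ𝒢 κ t ht), annihilatorMapOfLE_comp_ι, hc]
  · rintro ⟨c, hc⟩
    refine ⟨c ≫ annihilatorMapOfLE κ φ𝒢 t' ht', ?_⟩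
    rw [Category.assoc, ← Category.assoc (annihilatorMapOfLE κ φ𝒢 t' ht'), annihilatorMapOfLE_comp_ι, hc]

/-! ## §2b The (KW) socket in `e₀`-currency — the docking law (iv) converts it to a statement on `G`-points (closed helper) -/

/-- **`exists_annihilator_iff_of_dock`** — through the docking law (iv) `jW ≫ e ≫ j𝒢^D = eW` (the package՚s law at the W-line՚s named `e₀`), a `T`-point `x` of `W`
lies in the `eW`-annihilator of `κ : 𝒦 ↪ 𝒢l` iff the character `(x ≫ jW) ≫ e` of `G` is trivial on `𝒦 ↪ 𝒢l ↪ G`: `((x ≫ jW) ≫ e) ≫ (κ ≫ j𝒢)^D = 1`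
(★ `exists_eq_comp_annihilatorι_iff`, ★ `comp_cartierDualMap_eq_one_iff`, ★ contravariance `cartierDualMap_comp`). So the ROOF road may pay (KW) as
(KW₀) «`β(s)x ∈ Ker q̄ ↔ e(x)` kills `𝒦`» — the Weil-pairing orthogonality «`sp(N) = H_L^⊥`» read at level `q` on `G = A[q]`, with no annihilator object.
[cite: Tate1997FiniteFlatGroupSchemes, §(3.8) p. 146] [cite: MumfordAV1970, §20 (I) p. 186, §23 Thm. 2 p. 231] -/
theorem exists_annihilator_iff_of_dock [IsAffine G.left] [Module.Free k (Alg G)] [Module.Finite k (Alg G)]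
    (𝒢l : SchemeOver k) [GrpObj 𝒢l] [IsCommMonObj 𝒢l] [IsAffine 𝒢l.left] [Module.Free k (Alg 𝒢l)] [Module.Finite k (Alg 𝒢l)]
    (j𝒢 : 𝒢l ⟶ G) [IsMonHom j𝒢]
    (𝒦 : SchemeOver k) [GrpObj 𝒦] [IsCommMonObj 𝒦] [IsAffine 𝒦.left] [Module.Free k (Alg 𝒦)] [Module.Finite k (Alg 𝒦)]
    (κ : 𝒦 ⟶ 𝒢l) [IsMonHom κ] (eW : W ≅ cartierDual 𝒢l)
    -- the docking law (iv) at a duality `e` of `G` (the W-line՚s `e₀`)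
    (e : G ⟶ cartierDual G) (hdock : jW ≫ e ≫ cartierDualMap j𝒢 = eW.hom)
    ⦃T : SchemeOver k⦄ (x : T ⟶ W) :
    (∃ c : T ⟶ annihilator κ, c ≫ (annihilatorι κ ≫ eW.inv) = x) ↔ ((x ≫ jW) ≫ e) ≫ cartierDualMap (κ ≫ j𝒢) = 1 := by
  have h1 : (∃ c : T ⟶ annihilator κ, c ≫ (annihilatorι κ ≫ eW.inv) = x) ↔ ∃ c : T ⟶ annihilator κ, c ≫ annihilatorι κ = x ≫ eW.hom := by
    refine exists_congr fun c => ?_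
    rw [← Category.assoc, Iso.comp_inv_eq]
  rw [h1, exists_eq_comp_annihilatorι_iff, ← comp_cartierDualMap_eq_one_iff, ← hdock, cartierDualMap_comp]
  simp only [Category.assoc]

omit [CommRing O] in
/-- **`kw_of_dock`** — (KW₀) in `e`-currency ⇒ the head՚s socket (KW) in dock currency. [cite: Tate1997FiniteFlatGroupSchemes, §(3.8) p. 146] [cite: MumfordAV1970, §23 Thm. 2 p. 231] -/
theorem kw_of_dock [IsAffine G.left] [Module.Free k (Alg G)] [Module.Finite k (Alg G)]
    (𝒢l : SchemeOver k) [GrpObj 𝒢l] [IsCommMonObj 𝒢l] [IsAffine 𝒢l.left] [Module.Free k (Alg 𝒢l)] [Module.Finite k (Alg 𝒢l)]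
    (j𝒢 : 𝒢l ⟶ G) [IsMonHom j𝒢]
    (𝒦 : SchemeOver k) [GrpObj 𝒦] [IsCommMonObj 𝒦] [IsAffine 𝒦.left] [Module.Free k (Alg 𝒦)] [Module.Finite k (Alg 𝒦)]
    (κ : 𝒦 ⟶ 𝒢l) [IsMonHom κ] (eW : W ≅ cartierDual 𝒢l)
    (e : G ⟶ cartierDual G) (hdock : jW ≫ e ≫ cartierDualMap j𝒢 = eW.hom)
    {B : AbelianSchemeOver (Spec (.of k))} (qbar : A.X ⟶ B.X) (s : O)
    -- (KW₀): on `W`, «`β(s)x` is killed by `j ≫ q̄`» iff «the character `e(x)` is trivial on `𝒦`»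
    (hKW₀ : ∀ ⦃T : SchemeOver k⦄ (x : T ⟶ W), (((x ≫ jW) ≫ β s) ≫ j) ≫ qbar = 1 ↔ ((x ≫ jW) ≫ e) ≫ cartierDualMap (κ ≫ j𝒢) = 1)
    ⦃T : SchemeOver k⦄ (x : T ⟶ W) :
    (((x ≫ jW) ≫ β s) ≫ j) ≫ qbar = 1 ↔ ∃ c : T ⟶ annihilator κ, c ≫ (annihilatorι κ ≫ eW.inv) = x := by
  rw [hKW₀ x, exists_annihilator_iff_of_dock G W jW 𝒢l j𝒢 𝒦 κ eW e hdock x]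

/-! ## §3 HEAD — the `w`-block law (rL-w), sorry-free over the sockets (K)(KW)(E), the arithmetic rows and `hqβ` -/

/-- **`rL_W` — THE `w`-BLOCK SECTION OF (rL)**: for a `T`-point `x` of `W`, `x ≫ F^{(r)}_{A∕k} = 1 ↔ ∀ a ∈ 𝔠, x ≫ ι(a) ≫ q̄ = 1`.
Chain: package law (v) `hlawW` → (E) `exists_annihilator_iff_of_factor` → (KW) `hKW` (level shift `β s`, ANY `s : 𝒪`) → `rlw_shift`.
[cite: MumfordAV1970, §20 (I) p. 186, §23 Thm. 2 p. 231] [cite: Liu2021, Prop. D.8 (3) pp. 136–138] -/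
theorem rL_W
    -- package laws: (α) the layer calculus of `β`, (iii) the `W`-reading
    (hβj : ∀ a, β a ≫ j = j ≫ act.i a) (hβ1 : β 1 = 𝟙 G) (hβadd : ∀ a b, β (a + b) = β a * β b)
    (hβmul : ∀ a b, β (a * b) = β b ≫ β a) (hq : (𝟙 G) ^ (p ^ r) = 1)
    (hW : ∀ ⦃T : SchemeOver k⦄ (x : T ⟶ G), (∃ s : T ⟶ W, s ≫ jW = x) ↔ x ≫ β (star εu) = x)
    -- the ROOF road's datum `q̄ : A → B̄`, co-ideal `𝔠`, shift element `s`; `Ker q̄ ∩ A[q]` is `β`-stable; the two arithmetic rows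
    {B : AbelianSchemeOver (Spec (.of k))} (qbar : A.X ⟶ B.X) (𝔠 : Ideal O) (s : O)
    (hqβ : ∀ (b : O) ⦃T : SchemeOver k⦄ (z : T ⟶ G), (z ≫ j) ≫ qbar = 1 → ((z ≫ β b) ≫ j) ≫ qbar = 1)
    (h𝔠₁ : ∀ a ∈ 𝔠, ∃ b c₁ : O, a * star εu = s * b + (p ^ r : ℕ) * c₁)
    (h𝔠₂ : ∃ a ∈ 𝔠, ∃ b c₂ : O, s * star εu = a * b + (p ^ r : ℕ) * c₂)
    -- the `c•w`-layer `𝒢l`, its Frobenius sublayer `Φ𝒢`, the dock `eW` (package data) and the kernel reading `κ : 𝒦 ↪ 𝒢l` of `q̄` (ROOF road)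
    (𝒢l : SchemeOver k) [GrpObj 𝒢l] [IsCommMonObj 𝒢l] [IsAffine 𝒢l.left]
    (Φ𝒢 : SchemeOver k) [GrpObj Φ𝒢] [IsCommMonObj Φ𝒢] [IsAffine Φ𝒢.left] [Module.Free k (Alg Φ𝒢)] [Module.Finite k (Alg Φ𝒢)]
    (φ𝒢 : Φ𝒢 ⟶ 𝒢l) [IsMonHom φ𝒢]
    (𝒦 : SchemeOver k) [GrpObj 𝒦] [IsCommMonObj 𝒦] [IsAffine 𝒦.left] [Module.Free k (Alg 𝒦)] [Module.Finite k (Alg 𝒦)]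
    (κ : 𝒦 ⟶ 𝒢l) [IsMonHom κ] (eW : W ≅ cartierDual 𝒢l)
    -- (E) HEART-FROB′ on the `c•w`-layer: `Φ𝒢` and `𝒦` are the same subgroup of `𝒢l`
    (t : Φ𝒢 ⟶ 𝒦) [IsMonHom t] (ht : t ≫ κ = φ𝒢) (t' : 𝒦 ⟶ Φ𝒢) [IsMonHom t'] (ht' : t' ≫ φ𝒢 = κ)
    -- package law (v): THE `w`-BLOCK FROBENIUS LAW at `eW`
    [PerfectField k] [Fact p.Prime] [CharP k p]
    (hlawW : ∀ ⦃T : SchemeOver k⦄ (x : T ⟶ W),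
      (∃ c : T ⟶ annihilator φ𝒢, c ≫ (annihilatorι φ𝒢 ≫ eW.inv) = x) ↔
        ((x ≫ jW) ≫ j) ≫ (A.toAffine.toAbelianVariety.relFrobenius p r).hom.hom.hom = 1)
    -- (KW) the kernel reading of `q̄` on the `w`-layer in dock currency, with the level shift `β s`
    (hKW : ∀ ⦃T : SchemeOver k⦄ (x : T ⟶ W),
      (((x ≫ jW) ≫ β s) ≫ j) ≫ qbar = 1 ↔ ∃ c : T ⟶ annihilator κ, c ≫ (annihilatorι κ ≫ eW.inv) = x)
    ⦃T : SchemeOver k⦄ (x : T ⟶ W) :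
    ((x ≫ jW) ≫ j) ≫ (A.toAffine.toAbelianVariety.relFrobenius p r).hom.hom.hom = 1 ↔
      ∀ a ∈ 𝔠, ((x ≫ jW) ≫ j) ≫ act.i a ≫ qbar = 1 := by
  rw [rlw_shift p r A star act εu G j β W jW hβj hβ1 hβadd hβmul hq hW qbar 𝔠 s hqβ h𝔠₁ h𝔠₂ x, hKW x,
    exists_annihilator_iff_of_factor W 𝒢l Φ𝒢 φ𝒢 𝒦 κ eW t ht t' ht' x, hlawW x]

/-- **`rL_W'` — the same on `A`-points**: for `t : T → A` with `t ≫ [q] = 1` and `t ≫ ι(ē) = t` (the `w`-component of a `q`-torsion point),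
`t ≫ F^{(r)} = 1 ↔ ∀ a ∈ 𝔠, t ≫ ι(a) ≫ q̄ = 1` — the shape ★ (E2-asm) `comp_relFrobenius_eq_one_iff_of_blocks` consumes at `ε_W = ι(ē)`.
[cite: MumfordAV1970, §20 (I) p. 186, §23 Thm. 2 p. 231] [cite: Liu2021, Prop. D.8 (3) pp. 136–138] -/
theorem rL_W'
    -- package laws: (α) the layer calculus of `β`, (iii) the `W`-reading
    (hβj : ∀ a, β a ≫ j = j ≫ act.i a) (hβ1 : β 1 = 𝟙 G) (hβadd : ∀ a b, β (a + b) = β a * β b)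
    (hβmul : ∀ a b, β (a * b) = β b ≫ β a) (hq : (𝟙 G) ^ (p ^ r) = 1)
    (hW : ∀ ⦃T : SchemeOver k⦄ (x : T ⟶ G), (∃ s : T ⟶ W, s ≫ jW = x) ↔ x ≫ β (star εu) = x)
    -- the ROOF road's datum `q̄ : A → B̄`, co-ideal `𝔠`, shift element `s`; `Ker q̄ ∩ A[q]` is `β`-stable; the two arithmetic rows
    {B : AbelianSchemeOver (Spec (.of k))} (qbar : A.X ⟶ B.X) (𝔠 : Ideal O) (s : O)
    (hqβ : ∀ (b : O) ⦃T : SchemeOver k⦄ (z : T ⟶ G), (z ≫ j) ≫ qbar = 1 → ((z ≫ β b) ≫ j) ≫ qbar = 1)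
    (h𝔠₁ : ∀ a ∈ 𝔠, ∃ b c₁ : O, a * star εu = s * b + (p ^ r : ℕ) * c₁)
    (h𝔠₂ : ∃ a ∈ 𝔠, ∃ b c₂ : O, s * star εu = a * b + (p ^ r : ℕ) * c₂)
    -- the `c•w`-layer `𝒢l`, its Frobenius sublayer `Φ𝒢`, the dock `eW` (package data) and the kernel reading `κ : 𝒦 ↪ 𝒢l` of `q̄` (ROOF road)
    (𝒢l : SchemeOver k) [GrpObj 𝒢l] [IsCommMonObj 𝒢l] [IsAffine 𝒢l.left]
    (Φ𝒢 : SchemeOver k) [GrpObj Φ𝒢] [IsCommMonObj Φ𝒢] [IsAffine Φ𝒢.left] [Module.Free k (Alg Φ𝒢)] [Module.Finite k (Alg Φ𝒢)]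
    (φ𝒢 : Φ𝒢 ⟶ 𝒢l) [IsMonHom φ𝒢]
    (𝒦 : SchemeOver k) [GrpObj 𝒦] [IsCommMonObj 𝒦] [IsAffine 𝒦.left] [Module.Free k (Alg 𝒦)] [Module.Finite k (Alg 𝒦)]
    (κ : 𝒦 ⟶ 𝒢l) [IsMonHom κ] (eW : W ≅ cartierDual 𝒢l)
    -- (E) HEART-FROB′ on the `c•w`-layer: `Φ𝒢` and `𝒦` are the same subgroup of `𝒢l`
    (t : Φ𝒢 ⟶ 𝒦) [IsMonHom t] (ht : t ≫ κ = φ𝒢) (t' : 𝒦 ⟶ Φ𝒢) [IsMonHom t'] (ht' : t' ≫ φ𝒢 = κ)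
    -- package law (v): THE `w`-BLOCK FROBENIUS LAW at `eW`
    [PerfectField k] [Fact p.Prime] [CharP k p]
    (hlawW : ∀ ⦃T : SchemeOver k⦄ (x : T ⟶ W),
      (∃ c : T ⟶ annihilator φ𝒢, c ≫ (annihilatorι φ𝒢 ≫ eW.inv) = x) ↔
        ((x ≫ jW) ≫ j) ≫ (A.toAffine.toAbelianVariety.relFrobenius p r).hom.hom.hom = 1)
    -- (KW) the kernel reading of `q̄` on the `w`-layer in dock currency, with the level shift `β s`
    (hKW : ∀ ⦃T : SchemeOver k⦄ (x : T ⟶ W),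
      (((x ≫ jW) ≫ β s) ≫ j) ≫ qbar = 1 ↔ ∃ c : T ⟶ annihilator κ, c ≫ (annihilatorι κ ≫ eW.inv) = x)
    -- package pin: `G = A[q]`
    [IsClosedImmersion j.left]
    (hG : ∀ ⦃T : SchemeOver k⦄ (t : T ⟶ A.X),
      (∃ s : T ⟶ G, s ≫ j = t) ↔ t ≫ ((((p ^ r : ℕ) : ℤ) • 𝟙 A.toAffine.toAbelianVariety).hom.hom.hom) = 1)
    ⦃T : SchemeOver k⦄ (tA : T ⟶ A.X)
    (htors : tA ≫ ((((p ^ r : ℕ) : ℤ) • 𝟙 A.toAffine.toAbelianVariety).hom.hom.hom) = 1) (hfix : tA ≫ act.i (star εu) = tA) :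
    tA ≫ (A.toAffine.toAbelianVariety.relFrobenius p r).hom.hom.hom = 1 ↔ ∀ a ∈ 𝔠, tA ≫ act.i a ≫ qbar = 1 := by
  obtain ⟨s, rfl⟩ := (hG tA).2 htors
  have hs : s ≫ β (star εu) = s := by
    haveI : Mono j := Over.mono_of_mono_left j
    rw [← cancel_mono j, Category.assoc, hβj, ← Category.assoc, hfix]
  obtain ⟨x, rfl⟩ := (hW s).2 hs
  exact rL_W p r A star act εu G j β W jW hβj hβ1 hβadd hβmul hq hW qbar 𝔠 s hqβ h𝔠₁ h𝔠₂ 𝒢l Φ𝒢 φ𝒢 𝒦 κ eW t ht t' ht' hlawW hKW x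

/-! ## §4 (ED. 4) The socket `hqβ` from `Roof₀` (r4₀) -/

omit [GrpObj G] [IsCommMonObj G] in
/-- **`hqβ_of_descends`** — `Roof₀` (r4₀) ⇒ the socket `hqβ` of `rL_W`: if every `ι(a)` descends along the homomorphism `q̄ : A → B̄` to some (bare)
endomorphism `b` of `B̄` (`ι(a) ≫ q̄ = q̄ ≫ b`), then «`z ≫ j` is killed by `q̄`» implies «`z ≫ β c ≫ j` is killed by `q̄`» for every `c : 𝒪` — the (α) law
`β c ≫ j = j ≫ ι(c)`, and `b` preserves the unit since `η ≫ q̄ = η`, `η ≫ ι(c) = η`.  No group structure on `G` is used.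
[cite: MumfordAV1970, §19 Thm. 4 (p. 180)] [cite: Liu2021, Prop. D.8 (3) pp. 136–138] -/
theorem hqβ_of_descends (hβj : ∀ a, β a ≫ j = j ≫ act.i a)
    {B : AbelianSchemeOver (Spec (.of k))} (qbar : A.X ⟶ B.X) [IsMonHom qbar]
    (hq4 : ∀ a : O, ∃ b : B.X ⟶ B.X, act.i a ≫ qbar = qbar ≫ b)
    (c : O) ⦃T : SchemeOver k⦄ (z : T ⟶ G) (hz : (z ≫ j) ≫ qbar = 1) : ((z ≫ β c) ≫ j) ≫ qbar = 1 := by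
  obtain ⟨bB, hbB⟩ := hq4 c
  haveI : IsMonHom (act.i c) := act.isMonHom c
  have hη : η[B.X] ≫ bB = η[B.X] := by
    rw [← IsMonHom.one_hom (f := qbar), Category.assoc, ← hbB, ← Category.assoc, IsMonHom.one_hom (f := act.i c)]
  have h1 : (1 : T ⟶ B.X) ≫ bB = 1 := by
    rw [Hom.one_def, Category.assoc, hη]
  calc ((z ≫ β c) ≫ j) ≫ qbar = (z ≫ (β c ≫ j)) ≫ qbar := by rw [Category.assoc z]
    _ = ((z ≫ j) ≫ act.i c) ≫ qbar := by rw [hβj]; simp only [Category.assoc]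
    _ = ((z ≫ j) ≫ qbar) ≫ bB := by rw [Category.assoc (z ≫ j), hbB, Category.assoc (z ≫ j)]
    _ = 1 := by rw [hz, h1]

omit [GrpObj G] [IsCommMonObj G] in
/-- **`hqβ_of_roof4`** — the same from (r4₀)'s CONJUNCTIVE shape `∀ a, ∃ b, ι(a) ≫ q̄ = q̄ ≫ b ∧ ι″(a) ≫ c̄ = c̄ ≫ b` (Defs `Roof₀` :566; the `c̄`-half is dropped),
delivering the `hqβ` binder of `rlw_shift`∕`rL_W`∕`rL_W'` verbatim. [cite: MumfordAV1970, §19 Thm. 4 (p. 180)] [cite: Liu2021, Prop. D.8 (3) pp. 136–138] -/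
theorem hqβ_of_roof4 (hβj : ∀ a, β a ≫ j = j ≫ act.i a)
    {B : AbelianSchemeOver (Spec (.of k))} (qbar : A.X ⟶ B.X) [IsMonHom qbar]
    {A'' : AbelianSchemeOver (Spec (.of k))} (ι'' : O → (A''.X ⟶ A''.X)) (cbar : A''.X ⟶ B.X)
    (hr4 : ∀ a : O, ∃ b : B.X ⟶ B.X, act.i a ≫ qbar = qbar ≫ b ∧ ι'' a ≫ cbar = cbar ≫ b) :
    ∀ (c : O) ⦃T : SchemeOver k⦄ (z : T ⟶ G), (z ≫ j) ≫ qbar = 1 → ((z ≫ β c) ≫ j) ≫ qbar = 1 :=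
  fun c _ z hz => hqβ_of_descends A act G j β hβj qbar (fun a => (hr4 a).imp fun _ h => h.1) c z hz

/-! ## §5 (ED. 4) The HEAD in the `law`-binder currency of ★ (rL-asm) -/

/-- **`law_w` — THE (rL-asm) PER-BLOCK LAW AT THE `w`-INDEX**: for every `q`-torsion `T`-point `x` of `A` fixed by `ι(ē)` (`ē = star εu`),
`x ≫ F^{(r)} = 1 ↔ ∀ a ∈ 𝔠, x ≫ ι(a) ≫ q̄ = 1` — EXACTLY the `law i` binder of ★ `AbelianSchemes/FrobeniusKernelLawBlockAssembly.comp_relFrobeniusOver_eq_one_iff_of_torsion_blocks`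
at `e i = star εu`, from the hypotheses of `rL_W'` (tokens: `A.mulN (p ^ r)` ↔ `((p ^ r : ℕ) : ℤ) • 𝟙` by `mulN_eq_zsmul_id`; `relFrobeniusOver p r A.X = 1` is the
`(A.toAffine.toAbelianVariety.relFrobenius p r).hom.hom.hom`-form by `rfl`).  The ROOF road feeds the other indices (`c•w`, banal) from their own suppliers.
[cite: MumfordAV1970, §20 (I) p. 186, §23 Thm. 2 p. 231] [cite: Liu2021, Prop. D.8 (3) pp. 136–138] -/
theorem law_w
    -- package laws: (α) the layer calculus of `β`, (iii) the `W`-reading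
    (hβj : ∀ a, β a ≫ j = j ≫ act.i a) (hβ1 : β 1 = 𝟙 G) (hβadd : ∀ a b, β (a + b) = β a * β b)
    (hβmul : ∀ a b, β (a * b) = β b ≫ β a) (hq : (𝟙 G) ^ (p ^ r) = 1)
    (hW : ∀ ⦃T : SchemeOver k⦄ (x : T ⟶ G), (∃ s : T ⟶ W, s ≫ jW = x) ↔ x ≫ β (star εu) = x)
    -- the ROOF road's datum `q̄ : A → B̄`, co-ideal `𝔠`, shift element `s`; `Ker q̄ ∩ A[q]` is `β`-stable; the two arithmetic rows
    {B : AbelianSchemeOver (Spec (.of k))} (qbar : A.X ⟶ B.X) (𝔠 : Ideal O) (s : O)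
    (hqβ : ∀ (b : O) ⦃T : SchemeOver k⦄ (z : T ⟶ G), (z ≫ j) ≫ qbar = 1 → ((z ≫ β b) ≫ j) ≫ qbar = 1)
    (h𝔠₁ : ∀ a ∈ 𝔠, ∃ b c₁ : O, a * star εu = s * b + (p ^ r : ℕ) * c₁)
    (h𝔠₂ : ∃ a ∈ 𝔠, ∃ b c₂ : O, s * star εu = a * b + (p ^ r : ℕ) * c₂)
    -- the `c•w`-layer `𝒢l`, its Frobenius sublayer `Φ𝒢`, the dock `eW` (package data) and the kernel reading `κ : 𝒦 ↪ 𝒢l` of `q̄` (ROOF road)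
    (𝒢l : SchemeOver k) [GrpObj 𝒢l] [IsCommMonObj 𝒢l] [IsAffine 𝒢l.left]
    (Φ𝒢 : SchemeOver k) [GrpObj Φ𝒢] [IsCommMonObj Φ𝒢] [IsAffine Φ𝒢.left] [Module.Free k (Alg Φ𝒢)] [Module.Finite k (Alg Φ𝒢)]
    (φ𝒢 : Φ𝒢 ⟶ 𝒢l) [IsMonHom φ𝒢]
    (𝒦 : SchemeOver k) [GrpObj 𝒦] [IsCommMonObj 𝒦] [IsAffine 𝒦.left] [Module.Free k (Alg 𝒦)] [Module.Finite k (Alg 𝒦)]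
    (κ : 𝒦 ⟶ 𝒢l) [IsMonHom κ] (eW : W ≅ cartierDual 𝒢l)
    -- (E) HEART-FROB′ on the `c•w`-layer: `Φ𝒢` and `𝒦` are the same subgroup of `𝒢l`
    (t : Φ𝒢 ⟶ 𝒦) [IsMonHom t] (ht : t ≫ κ = φ𝒢) (t' : 𝒦 ⟶ Φ𝒢) [IsMonHom t'] (ht' : t' ≫ φ𝒢 = κ)
    -- package law (v): THE `w`-BLOCK FROBENIUS LAW at `eW`
    [PerfectField k] [Fact p.Prime] [CharP k p]
    (hlawW : ∀ ⦃T : SchemeOver k⦄ (x : T ⟶ W),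
      (∃ c : T ⟶ annihilator φ𝒢, c ≫ (annihilatorι φ𝒢 ≫ eW.inv) = x) ↔
        ((x ≫ jW) ≫ j) ≫ (A.toAffine.toAbelianVariety.relFrobenius p r).hom.hom.hom = 1)
    -- (KW) the kernel reading of `q̄` on the `w`-layer in dock currency, with the level shift `β s`
    (hKW : ∀ ⦃T : SchemeOver k⦄ (x : T ⟶ W),
      (((x ≫ jW) ≫ β s) ≫ j) ≫ qbar = 1 ↔ ∃ c : T ⟶ annihilator κ, c ≫ (annihilatorι κ ≫ eW.inv) = x)
    -- package pin: `G = A[q]`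
    [IsClosedImmersion j.left]
    (hG : ∀ ⦃T : SchemeOver k⦄ (t : T ⟶ A.X),
      (∃ s : T ⟶ G, s ≫ j = t) ↔ t ≫ ((((p ^ r : ℕ) : ℤ) • 𝟙 A.toAffine.toAbelianVariety).hom.hom.hom) = 1) :
    ∀ ⦃T : SchemeOver k⦄ (x : T ⟶ A.X), x ≫ A.mulN (p ^ r) = 1 → x ≫ act.i (star εu) = x →
      (x ≫ relFrobeniusOver p r A.X = (1 : T ⟶ (A.baseChange (frobSpec k p r)).X) ↔ ∀ a ∈ 𝔠, x ≫ act.i a ≫ qbar = 1) := by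
  intro T x hN hfix
  rw [mulN_eq_zsmul_id A (p ^ r)] at hN
  exact rL_W' p r A star act εu G j β W jW hβj hβ1 hβadd hβmul hq hW qbar 𝔠 s hqβ h𝔠₁ h𝔠₂ 𝒢l Φ𝒢 φ𝒢 𝒦 κ eW t ht t' ht' hlawW hKW hG x hN hfix

end WBlockLaw

end Summit.HodgeConjecture.HodgeConjecture.Cruxes.HLiu418.F0P6bWDock

end
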